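import Mathlib.Algebra.BigOperators.Field
import Mathlib.MeasureTheory.Integral.Lebesgue.Add
import Mathlib.MeasureTheory.Measure.Typeclasses.Probability
import HarnessLib

/-!
# `TransferActivityTails` (stmt-AtomisticToContinuum-16624), line `Sketch` (idea `predictor-drift-doob`):
stub `stub_driftLLNEngineAvg`

Pure probability / `ℝ≥0∞` bookkeeping: the particle-AVERAGED "drift ⇒ LLN" engine follows from the per-sequence
engine (the displayed antecedent of the registered signature).  Given `n` nonnegative block sequences
`X i : ℕ → Ω → ℝ` on one probability space, each satisfying the integrated drift hypothesis, and bounds on the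
particle AVERAGES of the overshoots `(X i j − M)₊`, `(X i j − M′)₊` (each `j < K`) and of `X i j` (each `j < L`):
* swap `Σ_i` and `∫⁻` in the averaged hypotheses (`lintegral_finsetSum'`, `ENNReal.ofReal_sum_of_nonneg`,
  `ENNReal.ofReal_mul`) to get summed single-time bounds, hence finite per-particle summed overshoots `Δ_i, Δ′_i`
  and head masses `μ_i`;
* feed the per-sequence engine, particle by particle, the real constants `δ_i := Δ_i.toReal / K`,
  `δ′_i := Δ′_i.toReal / K`, `m_i := μ_i.toReal / L` (its summed hypotheses then hold with equality,
  `ENNReal.ofReal_toReal`);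
* average the `n` conclusions: the engine's bound `M′(δ_i + (M² + L m_i)/K) + δ′_i` is affine in
  `(δ_i, m_i, δ′_i)`, whose particle sums are `≤ nδ, nm, nδ′`.
-/

noncomputable section

open MeasureTheory
open scoped ENNReal BigOperators

namespace Summit.AtomisticToContinuum.HydrodynamicLimit.Theorems.TransferActivityTailsDriftEngineAvg

/-- Linearity of the lower Lebesgue integral through `ofReal`: for `c ≥ 0` and nonnegative measurable `g i`,
`∫⁻ ofReal (c * Σ_{i ∈ s} g i) = ofReal c * Σ_{i ∈ s} ∫⁻ ofReal (g i)`. -/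
theorem lintegral_ofReal_mul_sum {Ω ι : Type*} [MeasurableSpace Ω] {μ : Measure Ω} (s : Finset ι)
    (g : ι → Ω → ℝ) {c : ℝ} (hc : 0 ≤ c) (hgm : ∀ i ∈ s, Measurable (g i))
    (hg0 : ∀ i ∈ s, ∀ z, 0 ≤ g i z) :
    ∫⁻ z, ENNReal.ofReal (c * ∑ i ∈ s, g i z) ∂μ =
      ENNReal.ofReal c * ∑ i ∈ s, ∫⁻ z, ENNReal.ofReal (g i z) ∂μ := by
  calc ∫⁻ z, ENNReal.ofReal (c * ∑ i ∈ s, g i z) ∂μ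
      = ∫⁻ z, ENNReal.ofReal c * ∑ i ∈ s, ENNReal.ofReal (g i z) ∂μ := by
        refine lintegral_congr fun z => ?_
        rw [ENNReal.ofReal_mul hc, ENNReal.ofReal_sum_of_nonneg fun i hi => hg0 i hi z]
    _ = ENNReal.ofReal c * ∑ i ∈ s, ∫⁻ z, ENNReal.ofReal (g i z) ∂μ := by
        rw [lintegral_const_mul' _ _ ENNReal.ofReal_ne_top,
          lintegral_finsetSum' _ fun i hi => (hgm i hi).ennreal_ofReal.aemeasurable]

/-- From an averaged bound to a summed one: if `0 < n` and the `g i` (`i : Fin n`) are nonnegative measurable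
with `∫⁻ ofReal (n⁻¹ Σ_i g i) ≤ b`, then `Σ_i ∫⁻ ofReal (g i) ≤ n * b`. -/
theorem sum_lintegral_le_of_average_le {Ω : Type*} [MeasurableSpace Ω] {μ : Measure Ω} {n : ℕ} (hn : 0 < n)
    (g : Fin n → Ω → ℝ) (hgm : ∀ i, Measurable (g i)) (hg0 : ∀ i z, 0 ≤ g i z) {b : ℝ≥0∞}
    (h : ∫⁻ z, ENNReal.ofReal ((n : ℝ)⁻¹ * ∑ i, g i z) ∂μ ≤ b) :
    ∑ i, ∫⁻ z, ENNReal.ofReal (g i z) ∂μ ≤ n * b := by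
  have hnR : (0 : ℝ) < n := by exact_mod_cast hn
  rw [lintegral_ofReal_mul_sum _ _ (inv_nonneg.2 hnR.le) (fun i _ => hgm i) (fun i _ => hg0 i),
    ENNReal.ofReal_inv_of_pos hnR, ENNReal.ofReal_natCast] at h
  calc ∑ i, ∫⁻ z, ENNReal.ofReal (g i z) ∂μ
      = n * ((n : ℝ≥0∞)⁻¹ * ∑ i, ∫⁻ z, ENNReal.ofReal (g i z) ∂μ) := by
        rw [← mul_assoc, ENNReal.mul_inv_cancel (Nat.cast_ne_zero.2 hn.ne') (ENNReal.natCast_ne_top n),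
          one_mul]
    _ ≤ n * b := mul_le_mul_right h _

/-- `toReal` bookkeeping: `x ≤ K * (n * ofReal b)` with `b ≥ 0` gives `x.toReal ≤ K * (n * b)`. -/
theorem toReal_le_of_le_natCast_mul {x : ℝ≥0∞} {K n : ℕ} {b : ℝ} (hb : 0 ≤ b)
    (h : x ≤ K * (n * ENNReal.ofReal b)) : x.toReal ≤ K * (n * b) := by
  refine ENNReal.toReal_le_of_le_ofReal (mul_nonneg (Nat.cast_nonneg K) (mul_nonneg (Nat.cast_nonneg n) hb)) ?_
  rwa [ENNReal.ofReal_mul (Nat.cast_nonneg K), ENNReal.ofReal_natCast, ENNReal.ofReal_mul (Nat.cast_nonneg n),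
    ENNReal.ofReal_natCast]

/-- `K * (n * ofReal b)` is finite in `ℝ≥0∞`. -/
theorem natCast_mul_natCast_mul_ofReal_ne_top (K n : ℕ) (b : ℝ) :
    (K : ℝ≥0∞) * (n * ENNReal.ofReal b) ≠ ∞ :=
  ENNReal.mul_ne_top (ENNReal.natCast_ne_top K)
    (ENNReal.mul_ne_top (ENNReal.natCast_ne_top n) ENNReal.ofReal_ne_top)

/-- `ofReal` does not see the positive part: `ofReal ((x − a)₊) = ofReal (x − a)`. -/
theorem ofReal_max_sub_zero (x a : ℝ) : ENNReal.ofReal (max (x - a) 0) = ENNReal.ofReal (x - a) := by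
  rcases le_total (x - a) 0 with h | h
  · rw [max_eq_right h, ENNReal.ofReal_zero, ENNReal.ofReal_of_nonpos h]
  · rw [max_eq_left h]

/-- **Stub `stub_driftLLNEngineAvg`** (registered signature; line `Sketch` of crux `TransferActivityTails`,
stmt-AtomisticToContinuum-16624): the per-sequence "drift ⇒ LLN" engine (the displayed antecedent, verbatim the
statement of the neighbouring stub `stub_driftLLNEngine`) implies its particle-averaged form.  Route-internal
probability bookkeeping, not a cited fact. -/
theorem stub_driftLLNEngineAvg :
    (∀ (Ω : Type) [MeasurableSpace Ω] (P : Measure Ω) [IsProbabilityMeasure P] (K L : ℕ) (X : ℕ → Ω → ℝ)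
    (ρ C M δ M' δ' m : ℝ),
    (∀ j, Measurable (X j)) → (∀ j ω, 0 ≤ X j ω) → 0 ≤ ρ → ρ < 1 → 0 ≤ C → 1 ≤ L → L < K →
    0 ≤ M → 0 ≤ δ → 0 ≤ M' → 0 ≤ δ' → 0 ≤ m →
    (∀ j : ℕ, L ≤ j + 1 → j + 1 < K → ∀ g : (Fin (j + 1) → ℝ) → ℝ, Measurable g → (∀ y, 0 ≤ g y ∧ g y ≤ 1) →
      ∫⁻ ω, ENNReal.ofReal (X (j + 1) ω * g (fun k => X k ω)) ∂P ≤
      ∫⁻ ω, ENNReal.ofReal ((ρ * ((L : ℝ)⁻¹ * ∑ k ∈ Finset.range L, X (j + 1 - L + k) ω) + C) *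
        g (fun k => X k ω)) ∂P) →
    (∑ j ∈ Finset.range K, ∫⁻ ω, ENNReal.ofReal (X j ω - M) ∂P ≤ ENNReal.ofReal (K * δ)) →
    (∑ j ∈ Finset.range K, ∫⁻ ω, ENNReal.ofReal (X j ω - M') ∂P ≤ ENNReal.ofReal (K * δ')) →
    (∑ j ∈ Finset.range L, ∫⁻ ω, ENNReal.ofReal (X j ω) ∂P ≤ ENNReal.ofReal (L * m)) →
    ∫⁻ ω, ENNReal.ofReal (Set.indicator {y : ℝ | 4 * (C + 1) / (1 - ρ) < y} (fun y => y)
        ((K : ℝ)⁻¹ * ∑ j ∈ Finset.range K, X j ω)) ∂P ≤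
      ENNReal.ofReal (M' * (δ + (M ^ 2 + L * m) / K) + δ')) →
    ∀ (Ω : Type) [MeasurableSpace Ω] (P : Measure Ω) [IsProbabilityMeasure P] (n K L : ℕ) (X : Fin n → ℕ → Ω → ℝ)
    (ρ C M δ M' δ' m : ℝ),
    0 < n → (∀ i j, Measurable (X i j)) → (∀ i j ω, 0 ≤ X i j ω) → 0 ≤ ρ → ρ < 1 → 0 ≤ C → 1 ≤ L → L < K →
    0 ≤ M → 0 ≤ δ → 0 ≤ M' → 0 ≤ δ' → 0 ≤ m →
    (∀ i : Fin n, ∀ j : ℕ, L ≤ j + 1 → j + 1 < K → ∀ g : (Fin (j + 1) → ℝ) → ℝ, Measurable g →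
      (∀ y, 0 ≤ g y ∧ g y ≤ 1) →
      ∫⁻ ω, ENNReal.ofReal (X i (j + 1) ω * g (fun k => X i k ω)) ∂P ≤
      ∫⁻ ω, ENNReal.ofReal ((ρ * ((L : ℝ)⁻¹ * ∑ k ∈ Finset.range L, X i (j + 1 - L + k) ω) + C) *
        g (fun k => X i k ω)) ∂P) →
    (∀ j, j < K → ∫⁻ ω, ENNReal.ofReal ((n : ℝ)⁻¹ * ∑ i, max (X i j ω - M) 0) ∂P ≤ ENNReal.ofReal δ) →
    (∀ j, j < K → ∫⁻ ω, ENNReal.ofReal ((n : ℝ)⁻¹ * ∑ i, max (X i j ω - M') 0) ∂P ≤ ENNReal.ofReal δ') →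
    (∀ j, j < L → ∫⁻ ω, ENNReal.ofReal ((n : ℝ)⁻¹ * ∑ i, X i j ω) ∂P ≤ ENNReal.ofReal m) →
    ∫⁻ ω, ENNReal.ofReal ((n : ℝ)⁻¹ * ∑ i, Set.indicator {y : ℝ | 4 * (C + 1) / (1 - ρ) < y} (fun y => y)
        ((K : ℝ)⁻¹ * ∑ j ∈ Finset.range K, X i j ω)) ∂P ≤
      ENNReal.ofReal (M' * (δ + (M ^ 2 + L * m) / K) + δ') := by
  intro hEng Ω _ P _ n K L X ρ C M δ M' δ' m hn hXm hX0 hρ0 hρ1 hC hL hLK hM hδ hM' hδ' hm hdrift hOM hOM' hmean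
  -- sizes
  have hnR : (0 : ℝ) < n := by exact_mod_cast hn
  have hL0 : 0 < L := hL
  have hK0 : 0 < K := lt_trans hL0 hLK
  have hLR : (0 : ℝ) < L := by exact_mod_cast hL0
  have hKR : (0 : ℝ) < K := by exact_mod_cast hK0
  -- Step 1: summed single-time bounds (swap `Σ_i` and `∫⁻` in the averaged hypotheses)
  have hOver : ∀ a b : ℝ,
      (∀ j, j < K → ∫⁻ ω, ENNReal.ofReal ((n : ℝ)⁻¹ * ∑ i, max (X i j ω - a) 0) ∂P ≤ ENNReal.ofReal b) →
      ∀ j ∈ Finset.range K, ∑ i, ∫⁻ ω, ENNReal.ofReal (X i j ω - a) ∂P ≤ n * ENNReal.ofReal b := by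
    intro a b hab j hj
    calc ∑ i, ∫⁻ ω, ENNReal.ofReal (X i j ω - a) ∂P
        = ∑ i, ∫⁻ ω, ENNReal.ofReal (max (X i j ω - a) 0) ∂P := by simp only [ofReal_max_sub_zero]
      _ ≤ n * ENNReal.ofReal b :=
          sum_lintegral_le_of_average_le hn (fun i ω => max (X i j ω - a) 0)
            (fun i => ((hXm i j).sub_const a).max measurable_const) (fun i ω => le_max_right _ _)
            (hab j (Finset.mem_range.1 hj))
  have hHead : ∀ j ∈ Finset.range L, ∑ i, ∫⁻ ω, ENNReal.ofReal (X i j ω) ∂P ≤ n * ENNReal.ofReal m :=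
    fun j hj => sum_lintegral_le_of_average_le hn (fun i ω => X i j ω) (fun i => hXm i j)
      (fun i ω => hX0 i j ω) (hmean j (Finset.mem_range.1 hj))
  -- Step 2: per-particle summed overshoots / head masses (in `ℝ≥0∞`), their particle sums, finiteness
  set Δ : Fin n → ℝ≥0∞ := fun i => ∑ j ∈ Finset.range K, ∫⁻ ω, ENNReal.ofReal (X i j ω - M) ∂P with hΔdef
  set Δ' : Fin n → ℝ≥0∞ := fun i => ∑ j ∈ Finset.range K, ∫⁻ ω, ENNReal.ofReal (X i j ω - M') ∂P with hΔ'def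
  set μL : Fin n → ℝ≥0∞ := fun i => ∑ j ∈ Finset.range L, ∫⁻ ω, ENNReal.ofReal (X i j ω) ∂P with hμLdef
  have hΔsum : ∑ i, Δ i ≤ K * (n * ENNReal.ofReal δ) := by
    calc ∑ i, Δ i = ∑ j ∈ Finset.range K, ∑ i, ∫⁻ ω, ENNReal.ofReal (X i j ω - M) ∂P := Finset.sum_comm
      _ ≤ ∑ j ∈ Finset.range K, n * ENNReal.ofReal δ := Finset.sum_le_sum (hOver M δ hOM)
      _ = K * (n * ENNReal.ofReal δ) := by rw [Finset.sum_const, Finset.card_range, nsmul_eq_mul]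
  have hΔ'sum : ∑ i, Δ' i ≤ K * (n * ENNReal.ofReal δ') := by
    calc ∑ i, Δ' i = ∑ j ∈ Finset.range K, ∑ i, ∫⁻ ω, ENNReal.ofReal (X i j ω - M') ∂P := Finset.sum_comm
      _ ≤ ∑ j ∈ Finset.range K, n * ENNReal.ofReal δ' := Finset.sum_le_sum (hOver M' δ' hOM')
      _ = K * (n * ENNReal.ofReal δ') := by rw [Finset.sum_const, Finset.card_range, nsmul_eq_mul]
  have hμLsum : ∑ i, μL i ≤ L * (n * ENNReal.ofReal m) := by
    calc ∑ i, μL i = ∑ j ∈ Finset.range L, ∑ i, ∫⁻ ω, ENNReal.ofReal (X i j ω) ∂P := Finset.sum_comm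
      _ ≤ ∑ j ∈ Finset.range L, n * ENNReal.ofReal m := Finset.sum_le_sum hHead
      _ = L * (n * ENNReal.ofReal m) := by rw [Finset.sum_const, Finset.card_range, nsmul_eq_mul]
  have hΔtop : ∀ i, Δ i ≠ ∞ := fun i => (ENNReal.lt_top_of_sum_ne_top
    (ne_top_of_le_ne_top (natCast_mul_natCast_mul_ofReal_ne_top K n δ) hΔsum) (Finset.mem_univ i)).ne
  have hΔ'top : ∀ i, Δ' i ≠ ∞ := fun i => (ENNReal.lt_top_of_sum_ne_top
    (ne_top_of_le_ne_top (natCast_mul_natCast_mul_ofReal_ne_top K n δ') hΔ'sum) (Finset.mem_univ i)).ne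
  have hμLtop : ∀ i, μL i ≠ ∞ := fun i => (ENNReal.lt_top_of_sum_ne_top
    (ne_top_of_le_ne_top (natCast_mul_natCast_mul_ofReal_ne_top L n m) hμLsum) (Finset.mem_univ i)).ne
  -- Step 3: the per-particle real constants; the engine, particle by particle
  set δi : Fin n → ℝ := fun i => (Δ i).toReal / K with hδidef
  set δi' : Fin n → ℝ := fun i => (Δ' i).toReal / K with hδi'def
  set mi : Fin n → ℝ := fun i => (μL i).toReal / L with hmidef
  have hδi0 : ∀ i, 0 ≤ δi i := fun i => div_nonneg ENNReal.toReal_nonneg hKR.le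
  have hδi'0 : ∀ i, 0 ≤ δi' i := fun i => div_nonneg ENNReal.toReal_nonneg hKR.le
  have hmi0 : ∀ i, 0 ≤ mi i := fun i => div_nonneg ENNReal.toReal_nonneg hLR.le
  have hH1 : ∀ i, Δ i ≤ ENNReal.ofReal (K * δi i) := fun i => by
    rw [show (K : ℝ) * δi i = (Δ i).toReal from mul_div_cancel₀ _ hKR.ne', ENNReal.ofReal_toReal (hΔtop i)]
  have hH2 : ∀ i, Δ' i ≤ ENNReal.ofReal (K * δi' i) := fun i => by
    rw [show (K : ℝ) * δi' i = (Δ' i).toReal from mul_div_cancel₀ _ hKR.ne', ENNReal.ofReal_toReal (hΔ'top i)]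
  have hH3 : ∀ i, μL i ≤ ENNReal.ofReal (L * mi i) := fun i => by
    rw [show (L : ℝ) * mi i = (μL i).toReal from mul_div_cancel₀ _ hLR.ne', ENNReal.ofReal_toReal (hμLtop i)]
  have hTail : ∀ i, ∫⁻ ω, ENNReal.ofReal (Set.indicator {y : ℝ | 4 * (C + 1) / (1 - ρ) < y} (fun y => y)
      ((K : ℝ)⁻¹ * ∑ j ∈ Finset.range K, X i j ω)) ∂P ≤
      ENNReal.ofReal (M' * (δi i + (M ^ 2 + L * mi i) / K) + δi' i) := fun i =>
    hEng Ω P K L (X i) ρ C M (δi i) M' (δi' i) (mi i) (hXm i) (hX0 i) hρ0 hρ1 hC hL hLK hM (hδi0 i) hM'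
      (hδi'0 i) (hmi0 i) (hdrift i) (hH1 i) (hH2 i) (hH3 i)
  -- Step 4: particle sums of the constants
  have hSD : ∑ i, δi i ≤ n * δ := by
    have h1 : ∑ i, (Δ i).toReal ≤ K * (n * δ) := by
      rw [← ENNReal.toReal_sum fun i _ => hΔtop i]; exact toReal_le_of_le_natCast_mul hδ hΔsum
    simp only [hδidef]
    rw [← Finset.sum_div, div_le_iff₀ hKR]
    exact h1.trans_eq (by ring)
  have hSD' : ∑ i, δi' i ≤ n * δ' := by
    have h1 : ∑ i, (Δ' i).toReal ≤ K * (n * δ') := by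
      rw [← ENNReal.toReal_sum fun i _ => hΔ'top i]; exact toReal_le_of_le_natCast_mul hδ' hΔ'sum
    simp only [hδi'def]
    rw [← Finset.sum_div, div_le_iff₀ hKR]
    exact h1.trans_eq (by ring)
  have hSM : ∑ i, mi i ≤ n * m := by
    have h1 : ∑ i, (μL i).toReal ≤ L * (n * m) := by
      rw [← ENNReal.toReal_sum fun i _ => hμLtop i]; exact toReal_le_of_le_natCast_mul hm hμLsum
    simp only [hmidef]
    rw [← Finset.sum_div, div_le_iff₀ hLR]
    exact h1.trans_eq (by ring)
  -- Step 5: the averaged bound is affine in the constants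
  have hsumB : ∑ i, (M' * (δi i + (M ^ 2 + L * mi i) / K) + δi' i) =
      M' * (∑ i, δi i + (n * M ^ 2 + L * ∑ i, mi i) / K) + ∑ i, δi' i := by
    have hterm : ∀ i, M' * (δi i + (M ^ 2 + L * mi i) / K) + δi' i =
        M' * δi i + M' * L / K * mi i + δi' i + M' * M ^ 2 / K := fun i => by ring
    simp only [hterm, Finset.sum_add_distrib, ← Finset.mul_sum, Finset.sum_const, Finset.card_univ,
      Fintype.card_fin, nsmul_eq_mul]
    ring
  have hfin : (n : ℝ)⁻¹ * ∑ i, (M' * (δi i + (M ^ 2 + L * mi i) / K) + δi' i) ≤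
      M' * (δ + (M ^ 2 + L * m) / K) + δ' := by
    rw [inv_mul_le_iff₀ hnR, hsumB]
    calc M' * (∑ i, δi i + (n * M ^ 2 + L * ∑ i, mi i) / K) + ∑ i, δi' i
        ≤ M' * (n * δ + (n * M ^ 2 + L * (n * m)) / K) + n * δ' := by gcongr
      _ = n * (M' * (δ + (M ^ 2 + L * m) / K) + δ') := by ring
  -- Step 6: average the `n` conclusions
  have hS : MeasurableSet {y : ℝ | 4 * (C + 1) / (1 - ρ) < y} := measurableSet_Ioi
  have hT0 : ∀ i ω, 0 ≤ Set.indicator {y : ℝ | 4 * (C + 1) / (1 - ρ) < y} (fun y => y)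
      ((K : ℝ)⁻¹ * ∑ j ∈ Finset.range K, X i j ω) := fun i ω =>
    Set.indicator_apply_nonneg fun _ =>
      mul_nonneg (inv_nonneg.2 hKR.le) (Finset.sum_nonneg fun j _ => hX0 i j ω)
  have hTm : ∀ i, Measurable fun ω => Set.indicator {y : ℝ | 4 * (C + 1) / (1 - ρ) < y} (fun y => y)
      ((K : ℝ)⁻¹ * ∑ j ∈ Finset.range K, X i j ω) := fun i =>
    (measurable_id'.indicator hS).comp ((Finset.measurable_sum _ fun j _ => hXm i j).const_mul _)
  have hB0 : ∀ i, 0 ≤ M' * (δi i + (M ^ 2 + L * mi i) / K) + δi' i := fun i => by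
    have := hδi0 i; have := hmi0 i; have := hδi'0 i; positivity
  calc ∫⁻ ω, ENNReal.ofReal ((n : ℝ)⁻¹ * ∑ i, Set.indicator {y : ℝ | 4 * (C + 1) / (1 - ρ) < y} (fun y => y)
        ((K : ℝ)⁻¹ * ∑ j ∈ Finset.range K, X i j ω)) ∂P
      = ENNReal.ofReal ((n : ℝ)⁻¹) * ∑ i, ∫⁻ ω, ENNReal.ofReal (Set.indicator {y : ℝ | 4 * (C + 1) / (1 - ρ) < y}
          (fun y => y) ((K : ℝ)⁻¹ * ∑ j ∈ Finset.range K, X i j ω)) ∂P :=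
        lintegral_ofReal_mul_sum _ (fun i ω => Set.indicator {y : ℝ | 4 * (C + 1) / (1 - ρ) < y} (fun y => y)
          ((K : ℝ)⁻¹ * ∑ j ∈ Finset.range K, X i j ω)) (inv_nonneg.2 hnR.le) (fun i _ => hTm i)
          (fun i _ => hT0 i)
    _ ≤ ENNReal.ofReal ((n : ℝ)⁻¹) * ∑ i, ENNReal.ofReal (M' * (δi i + (M ^ 2 + L * mi i) / K) + δi' i) := by
        gcongr with i _
        exact hTail i
    _ = ENNReal.ofReal ((n : ℝ)⁻¹ * ∑ i, (M' * (δi i + (M ^ 2 + L * mi i) / K) + δi' i)) := by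
        rw [ENNReal.ofReal_mul (inv_nonneg.2 hnR.le), ENNReal.ofReal_sum_of_nonneg fun i _ => hB0 i]
    _ ≤ ENNReal.ofReal (M' * (δ + (M ^ 2 + L * m) / K) + δ') := ENNReal.ofReal_le_ofReal hfin

end Summit.AtomisticToContinuum.HydrodynamicLimit.Theorems.TransferActivityTailsDriftEngineAvg

end
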